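import Summits.QuantumFields.YangMills.Theorems.AlphaInputsT3AC
import Summits.QuantumFields.Balaban3D.Proofs.Thm2AC
import HarnessLib

/-!
# `AlphaInputsT3AC` — THE FEED: Bałaban's Theorem 2 ((41) ∧ (47), `k ≤ K`) for the T³ family's block-averaged Gibbs tower from the
# AC (α) package, and its `dV`-a.e. reading on the cell's Radon–Nikodym tower `towerDensity`

Lane `pub-balaban3d`, seat alpha-1 (LINE 2 of the definition request `defn-AlphaInputsT3AC`, route `UnitScaleTilt`, cruxes `HistoryTail`
stmt-QuantumFields-18916 / `FluctuationComparisonRegPr` stmt-QuantumFields-19201).  The socket `AlphaInputsT3AC.Of F 𝔠` (this directory) says: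
for every `γ ∈ (0, (min γ₀ 1)²]` and every `K` there are minimizer data, expansion data `𝔖` and auxiliary data `𝔄` for which the lane's
31 (α) rows `AlphaAC.RunAlphaAC` hold at the AC tower of `XT3` — the tower whose averaging IS the cruxes' `blockAvg ℰp` (`avT3`), Haar
compatibility weakened to absolute continuity (a tree theorem), masses the exact transports.  THIS FILE applies the lane's AC Theorem 2
`Thm2AC.ineq41_47_of_alphaAC` (every printed constant, threshold and bookkeeping leaf discharged there) at that tower:

* `T3Scales_window` — the `≤`-window `g²ε₀ = γ ≤ (min γ₀ 1)²` of `T3Scales`;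
* `AlphaInputsT3AC.Of.ineq41_47` — under the package, (41)_k ∧ (47)_k for every `k ≤ K` for the AC tower of the package's own data;
* `AlphaInputsT3AC.Of.towerDensity_ineq41_47_ae` — the same read `dV`-a.e. on the cell's Radon–Nikodym tower
  `T3RestrictedUnitDensity.towerDensity F K ρ₀ k` from the Wilson start `ρ₀ = e^{−E}·e^{−β_K A}` (`rho_towerOfAC_ae_eq_towerDensity`): the
  `k`-fold `blockAvg ℰp`-renormalized Gibbs density of `T3UnitScaleTilt.gibbsK` is squeezed between the printed lower envelope (47) and the
  printed upper envelope (41) almost everywhere — the form a density statement CAN take (versions are determined only `dV`-a.e.).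

CONDITIONAL on the package (a hypothesis schema, never asserted); nothing of [Balaban1985UV3]'s analysis is claimed.  Not Theorem 1 ((5)),
not d = 4, not a continuum statement.

References: T. Bałaban, Commun. Math. Phys. 102 (1985) 255–275 [Balaban1985UV3], Thm 2 p.272, (41) p.266, (47) p.267.
-/

set_option autoImplicit false

noncomputable section

namespace Summit.QuantumFields.YangMills.Theorems

open MeasureTheory
open Literature.MathematicalPhysics.QuantumFieldTheory.Balaban1983to89
open Literature.MathematicalPhysics.QuantumFieldTheory.Balaban1983to89.B10 (Ineq41 Ineq47)
open Literature.MathematicalPhysics.QuantumFieldTheory.Balaban1983to89.T3ContinuumYM3Torus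
open Literature.MathematicalPhysics.QuantumFieldTheory.Balaban1983to89.T3UnitLawDensityEML (ℰp)
open Literature.MathematicalPhysics.QuantumFieldTheory.Balaban1983to89.T3RestrictedUnitDensity (towerDensity)
open Literature.MathematicalPhysics.QuantumFieldTheory.Balaban1983to89.Missing (boltzmann)
open Literature.MathematicalPhysics.QuantumFieldTheory.Balaban1985CMP102
open Literature.MathematicalPhysics.QuantumFieldTheory.Balaban1985CMP102.Setting
open Summit.QuantumFields.Balaban3D.Carriers
open Summit.QuantumFields.Balaban3D.Proofs.Primitives
open Summit.QuantumFields.Balaban3D.Proofs.GroupModelLieC (lieC)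
open Summit.QuantumFields.Balaban3D.Proofs.TowerAC
open Summit.QuantumFields.Balaban3D.Proofs.StandardAC
open Summit.QuantumFields.Balaban3D.Proofs.InputsAC
open Summit.QuantumFields.Balaban3D.Proofs.AlphaAC
open Summit.QuantumFields.Balaban3D.Proofs.Thm2AC

/-- **THE `≤`-WINDOW OF THE T³ SCALES**: `g²ε₀ = (√γ)²·1 = γ ≤ (min γ₀ 1)²` — the standing hypothesis of the lane's `≤`-family theorems
(`FamilyLE`, `Thm2AC`). [cite: Balaban1985UV3, (2) p.256] -/
theorem T3Scales_window (F : T3Family) (𝔠 : AlphaConsts F.L (suGroupModel 2).N) (γ : ℝ) (hγ : 0 < γ)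
    (hγ1 : γ ≤ (min 𝔠.gamma0 1) ^ 2) (K : ℕ) :
    (T3Scales F γ hγ (hγ1.trans (sq_min_one_le _ 𝔠.gamma0_pos)) K).g ^ 2 *
        (T3Scales F γ hγ (hγ1.trans (sq_min_one_le _ 𝔠.gamma0_pos)) K).ε₀ ≤ (min 𝔠.gamma0 1) ^ 2 := by
  show Real.sqrt γ ^ 2 * 1 ≤ _
  rw [Real.sq_sqrt hγ.le, mul_one]
  exact hγ1

/-- **THEOREM 2 OF [Balaban1985UV3] FOR THE T³ FAMILY'S BLOCK-AVERAGED TOWER, FROM THE AC (α) PACKAGE**: if `AlphaInputsT3AC.Of F 𝔠`, then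
for every `γ ∈ (0, (min γ₀ 1)²]` and every `K` the package's data `reg, U_k, U_k(·,h), 𝔖, 𝔄` satisfy the (α) rows AND the densities
`ρ_k = T^kρ₀` of the AC tower `towerOfAC 𝔠.lane (XT3 …) 𝔖` (averaging `blockAvg ℰp`, exact-transport masses) obey the inductive
inequalities (41) p. 266 and (47) p. 267 for every `k ≤ K` (`Thm2AC.ineq41_47_of_alphaAC` on the window `T3Scales_window`).
[cite: Balaban1985UV3, Thm 2 p.272 + (41) p.266 + (47) p.267] -/
theorem AlphaInputsT3AC.Of.ineq41_47 {F : T3Family} {𝔠 : AlphaConsts F.L (suGroupModel 2).N} (h : AlphaInputsT3AC.Of F 𝔠)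
    (γ : ℝ) (hγ : 0 < γ) (hγ1 : γ ≤ (min 𝔠.gamma0 1) ^ 2) (K : ℕ) :
    ∃ (reg : ℕ → Set (GaugeField (F.P K) 0 (Matrix.specialUnitaryGroup (Fin 2) ℂ)))
      (Uk : (k : ℕ) → GaugeField (F.P K) (k + 1) (Matrix.specialUnitaryGroup (Fin 2) ℂ) →
        GaugeField (F.P K) 0 (Matrix.specialUnitaryGroup (Fin 2) ℂ))
      (UkH : (k : ℕ) → Hist (F.P K) k → GaugeField (F.P K) k (Matrix.specialUnitaryGroup (Fin 2) ℂ) →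
        GaugeField (F.P K) 0 (Matrix.specialUnitaryGroup (Fin 2) ℂ))
      (hU0 : ∀ V : GaugeField (F.P K) 0 (Matrix.specialUnitaryGroup (Fin 2) ℂ), UkH 0 (Hist.triv (F.P K) 0) V = V)
      (hUs : ∀ (k : ℕ) (V : GaugeField (F.P K) (k + 1) (Matrix.specialUnitaryGroup (Fin 2) ℂ)),
        UkH (k + 1) (Hist.triv (F.P K) (k + 1)) V = Uk k V)
      (𝔖 : ∀ k, StepSeries (T3Scales F γ hγ (hγ1.trans (sq_min_one_le _ 𝔠.gamma0_pos)) K)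
        (Matrix.specialUnitaryGroup (Fin 2) ℂ) ↥(lieC (suGroupModel 2))
        (nblkOf (T3Scales F γ hγ (hγ1.trans (sq_min_one_le _ 𝔠.gamma0_pos)) K) 𝔠.lane.carrier k) k)
      (𝔄 : AlphaDataAC (suGroupModel 2) 𝔠
        (XT3 F γ hγ (hγ1.trans (sq_min_one_le _ 𝔠.gamma0_pos)) K reg Uk UkH hU0 hUs) 𝔖),
      RunAlphaAC (suGroupModel 2) 𝔠 (XT3 F γ hγ (hγ1.trans (sq_min_one_le _ 𝔠.gamma0_pos)) K reg Uk UkH hU0 hUs) 𝔖 𝔄 ∧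
      ∀ k, k ≤ K →
        Ineq41 (towerOfAC 𝔠.lane (XT3 F γ hγ (hγ1.trans (sq_min_one_le _ 𝔠.gamma0_pos)) K reg Uk UkH hU0 hUs) 𝔖) k ∧
        Ineq47 (towerOfAC 𝔠.lane (XT3 F γ hγ (hγ1.trans (sq_min_one_le _ 𝔠.gamma0_pos)) K reg Uk UkH hU0 hUs) 𝔖) k := by
  obtain ⟨reg, Uk, UkH, hU0, hUs, 𝔖, 𝔄, hR⟩ := h γ hγ hγ1 K
  exact ⟨reg, Uk, UkH, hU0, hUs, 𝔖, 𝔄, hR, fun k hk =>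
    ineq41_47_of_alphaAC (T3Scales_window F 𝔠 γ hγ hγ1 K) hR k hk⟩

/-- **THE SAME, READ `dV`-a.e. ON THE CELL'S RADON–NIKODYM TOWER**: under the package, for every `γ ∈ (0, (min γ₀ 1)²]`, `K` and `k ≤ K`, the
`k`-fold `blockAvg ℰp`-renormalized density `towerDensity F K ρ₀ k` of the Wilson start `ρ₀ = e^{−E}·e^{−β_K A}` (`E = E_0` the tower's (62)/(64)
constant) lies `dV`-almost everywhere between the printed envelopes: (47) `χ_k·exp[−main(triv) + Pint(triv) − E_k − Rm_k] ≤ ρ_k` and (41)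
`ρ_k ≤ LF_k(… exp[−main + Pint − E_k + Zterm + Rm_k])` — `Of.ineq41_47` transported along `rho_towerOfAC_ae_eq_towerDensity`.
[cite: Balaban1985UV3, Thm 2 p.272 + (41) p.266 + (47) p.267] -/
theorem AlphaInputsT3AC.Of.towerDensity_ineq41_47_ae {F : T3Family} {𝔠 : AlphaConsts F.L (suGroupModel 2).N}
    (h : AlphaInputsT3AC.Of F 𝔠) (γ : ℝ) (hγ : 0 < γ) (hγ1 : γ ≤ (min 𝔠.gamma0 1) ^ 2) (K : ℕ) :
    ∃ (reg : ℕ → Set (GaugeField (F.P K) 0 (Matrix.specialUnitaryGroup (Fin 2) ℂ)))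
      (Uk : (k : ℕ) → GaugeField (F.P K) (k + 1) (Matrix.specialUnitaryGroup (Fin 2) ℂ) →
        GaugeField (F.P K) 0 (Matrix.specialUnitaryGroup (Fin 2) ℂ))
      (UkH : (k : ℕ) → Hist (F.P K) k → GaugeField (F.P K) k (Matrix.specialUnitaryGroup (Fin 2) ℂ) →
        GaugeField (F.P K) 0 (Matrix.specialUnitaryGroup (Fin 2) ℂ))
      (hU0 : ∀ V : GaugeField (F.P K) 0 (Matrix.specialUnitaryGroup (Fin 2) ℂ), UkH 0 (Hist.triv (F.P K) 0) V = V)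
      (hUs : ∀ (k : ℕ) (V : GaugeField (F.P K) (k + 1) (Matrix.specialUnitaryGroup (Fin 2) ℂ)),
        UkH (k + 1) (Hist.triv (F.P K) (k + 1)) V = Uk k V)
      (𝔖 : ∀ k, StepSeries (T3Scales F γ hγ (hγ1.trans (sq_min_one_le _ 𝔠.gamma0_pos)) K)
        (Matrix.specialUnitaryGroup (Fin 2) ℂ) ↥(lieC (suGroupModel 2))
        (nblkOf (T3Scales F γ hγ (hγ1.trans (sq_min_one_le _ 𝔠.gamma0_pos)) K) 𝔠.lane.carrier k) k)
      (𝔄 : AlphaDataAC (suGroupModel 2) 𝔠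
        (XT3 F γ hγ (hγ1.trans (sq_min_one_le _ 𝔠.gamma0_pos)) K reg Uk UkH hU0 hUs) 𝔖),
      RunAlphaAC (suGroupModel 2) 𝔠 (XT3 F γ hγ (hγ1.trans (sq_min_one_le _ 𝔠.gamma0_pos)) K reg Uk UkH hU0 hUs) 𝔖 𝔄 ∧
      ∀ k, k ≤ K →
        let T := towerOfAC 𝔠.lane (XT3 F γ hγ (hγ1.trans (sq_min_one_le _ 𝔠.gamma0_pos)) K reg Uk UkH hU0 hUs) 𝔖
        let ρ₀ : GaugeField (F.P K) 0 (Matrix.specialUnitaryGroup (Fin 2) ℂ) → ℝ := fun U =>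
          Real.exp (-(B10.Ek (inputOfAC 𝔠.lane (XT3 F γ hγ (hγ1.trans (sq_min_one_le _ 𝔠.gamma0_pos)) K reg Uk UkH hU0 hUs) 𝔖).Estep
            K 0)) * boltzmann (F.P K) ((F.scheme ℰp γ).β K) U
        ∀ᵐ U ∂(fieldMeasure (F.P K) k (Matrix.specialUnitaryGroup (Fin 2) ℂ)),
          T.χ k U * Real.exp (-(T.mainT k (T.triv k) U) + T.Pint k (T.triv k) U - T.Ecst k - T.Rm k) ≤ towerDensity F K ρ₀ k U ∧
          towerDensity F K ρ₀ k U ≤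
            T.LF k U (fun h => -(T.mainT k h U) + T.Pint k h U - T.Ecst k + T.Zterm k h + T.Rm k) := by
  obtain ⟨reg, Uk, UkH, hU0, hUs, 𝔖, 𝔄, hR, h2⟩ := h.ineq41_47 γ hγ hγ1 K
  refine ⟨reg, Uk, UkH, hU0, hUs, 𝔖, 𝔄, hR, fun k hk => ?_⟩
  have hae := rho_towerOfAC_ae_eq_towerDensity 𝔠.lane
    (XT3 F γ hγ (hγ1.trans (sq_min_one_le _ 𝔠.gamma0_pos)) K reg Uk UkH hU0 hUs) rfl 𝔖 k (by omega)
  filter_upwards [hae] with U hU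
  exact ⟨hU ▸ (h2 k hk).2 U, hU ▸ (h2 k hk).1 U⟩

end Summit.QuantumFields.YangMills.Theorems

end
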